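import Literature.GroupTheory.FiniteAbelian.UnitAddCircleDuality
import HarnessLib

/-!
# A character non-degenerate on TWO rays, with prescribed kernel (the algebra of McCallum's
# Prop. 3.1 in kernel form at `p = 2`)

McCallum 1991, Prop. 3.1 (PDF p. 280: *"Let `φ ∈ Hom(C, E_{p^M})` … there exist infinitely many
primes `l` such that `φ = φ_{Frob(λ)}`"*) realises a CHARACTER of a finite subgroup `C` of
`H¹(K, E_{p^M})` as a localisation map; Kolyvagin's order bound (McCallum §5, (21)–(23)) consumes it
with a prescribed KERNEL `⟨T⟩` on `C = ⟨g₁, g₂, T⟩`. For `p` odd the target `E_{p^M} = E⁺ ⊕ E⁻` has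
two independent lines and a `τ`-adapted character with kernel exactly `⟨T⟩` exists
(`Literature.GroupTheory.FiniteAbelian.exists_addMonoidHom_ker_eq_of_involution`). At `p = 2` the
character takes values in ONE line `ℤP ≅ ℤ/2^M` (`E[2^M] = R_M P`, BSD route `GenusKolyvaginAtTwo`,
`GenusExact.exists_h1Eval_conj_mul_character_signStable`), and a character with kernel EXACTLY `⟨T⟩`
need not exist; what the order bound uses is only the kernel condition on the two RAYS `ℤg₁`, `ℤg₂`
(`HeegnerPointsKolyvaginVisibleDescentTelescopeProofs`: the visible kernel form `hCeb`). This file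
proves that such a character always exists, into ONE cyclic target:

* `exists_addMonoidHom_unitAddCircle_two_rays` — `G` finite abelian killed by `p^M`, `K ≤ G`,
  `g₁, g₂ ∈ G`: there is `χ : G →+ ℝ/ℤ` vanishing on `K` with
  **`χ(p^j g_k) = 0 ⟺ p^j g_k ∈ K`** for `k = 1, 2` and all `j` (values in the `p^M`-torsion
  `(1/p^M)ℤ/ℤ ≅ ℤ/p^M` of `ℝ/ℤ`).

Proof: in `D = G/K` let `b_k = p^{e_k−1} ḡ_k` generate the minimal subgroup of the cyclic `p`-group
`⟨ḡ_k⟩`; characters separate points (Serre, *Cours d'arithmétique* VI §1.1 Prop. 3), so some `χ₁`,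
`χ₂` have `χ₁(b₁) ≠ 0`, `χ₂(b₂) ≠ 0`, and one of `χ₁`, `χ₂`, `χ₁ + χ₂` is non-zero on BOTH `b₁`,
`b₂` (a group is not the union of two proper subgroups) — hence injective on both rays. Three rays
can fail (`(ℤ/2)²` and its three lines): two is exactly what McCallum's induction needs (the new
class `c(n_k)` and the new lift `s_{k+1}`). No definition, no named fact.

## References

* W. G. McCallum, *Kolyvagin's work on Shafarevich–Tate groups*, LMS LNS 153 (1991), 295–316:
  §3 (2)–(3), Prop. 3.1; §5 (21)–(23). [McCallumLMS1991]
* J.-P. Serre, *A Course in Arithmetic*, GTM 7, Chap. VI §1.1 Props. 1, 3. [Serre1973]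
-/

namespace Literature.GroupTheory.FiniteAbelian

universe u

variable {G : Type u} [AddCommGroup G]

/-- The minimal exponent: the least `e` with `p^e • g = 0`. [folklore] -/
private theorem exists_min_pow_smul_eq_zero {p M : ℕ} (hG : ∀ g : G, ((p : ℤ) ^ M) • g = 0)
    (g : G) : ∃ e : ℕ, ((p : ℤ) ^ e) • g = 0 ∧ ∀ j < e, ((p : ℤ) ^ j) • g ≠ 0 := by
  classical
  have h : ∃ e : ℕ, ((p : ℤ) ^ e) • g = 0 := ⟨M, hG g⟩
  exact ⟨Nat.find h, Nat.find_spec h, fun j hj ↦ Nat.find_min h hj⟩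

/-- **The ray criterion.** If `p^e g = 0` and `χ(p^{e-1} g) ≠ 0`, then for every `j`:
`χ(p^j g) = 0 ⟺ p^j g = 0` (the cyclic `p`-group `⟨g⟩` has a unique minimal subgroup, so a
homomorphism non-zero on it is injective on `⟨g⟩`). [cite: McCallumLMS1991, §3 (3) (the order of
`φ(c)` read on a ray)] -/
theorem apply_pow_smul_eq_zero_iff_of_apply_ne_zero {Y : Type*} [AddCommGroup Y] (χ : G →+ Y)
    {p : ℕ} {g : G} {e : ℕ} (he : ((p : ℤ) ^ e) • g = 0)
    (hb : e ≠ 0 → χ (((p : ℤ) ^ (e - 1)) • g) ≠ 0) (j : ℕ) :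
    χ (((p : ℤ) ^ j) • g) = 0 ↔ ((p : ℤ) ^ j) • g = 0 := by
  refine ⟨fun h ↦ ?_, fun h ↦ by rw [h, map_zero]⟩
  by_contra hne
  -- then `j < e`, and `b = p^{e-1} g = p^{e-1-j} (p^j g)` is killed by `χ`
  have hj : j < e := by
    by_contra hle
    exact hne (by
      obtain ⟨k, rfl⟩ := Nat.exists_eq_add_of_le (not_lt.mp hle)
      rw [pow_add, mul_comm, mul_smul, he, smul_zero])
  have he0 : e ≠ 0 := by omega
  apply hb he0
  rw [show e - 1 = (e - 1 - j) + j by omega, pow_add, mul_smul, map_zsmul, h, smul_zero]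

/-- **A character injective on two rays** (`p^M`-torsion finite abelian group, values in `ℝ/ℤ`):
for `γ₁, γ₂ ∈ D` there is `χ : D →+ ℝ/ℤ` with `χ(p^j γ_k) = 0 ⟺ p^j γ_k = 0` (`k = 1, 2`, all `j`).
Characters separate points; one of `χ₁`, `χ₂`, `χ₁ + χ₂` is non-zero on both minimal subgroups.
[cite: McCallumLMS1991, Prop. 3.1 (the character), §5 (21)–(23) (its two uses)]
[cite: Serre1973, Chap. VI §1.1 Prop. 3] -/
theorem exists_addMonoidHom_unitAddCircle_two_rays_of_torsion [Finite G] {p M : ℕ}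
    (hG : ∀ g : G, ((p : ℤ) ^ M) • g = 0) (γ₁ γ₂ : G) :
    ∃ χ : G →+ UnitAddCircle,
      (∀ j : ℕ, χ (((p : ℤ) ^ j) • γ₁) = 0 ↔ ((p : ℤ) ^ j) • γ₁ = 0) ∧
      (∀ j : ℕ, χ (((p : ℤ) ^ j) • γ₂) = 0 ↔ ((p : ℤ) ^ j) • γ₂ = 0) := by
  obtain ⟨e₁, he₁, hmin₁⟩ := exists_min_pow_smul_eq_zero hG γ₁
  obtain ⟨e₂, he₂, hmin₂⟩ := exists_min_pow_smul_eq_zero hG γ₂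
  -- characters non-zero on the minimal elements `b_k = p^{e_k - 1} γ_k` (when `e_k ≠ 0`)
  have hχ : ∀ {γ : G} {e : ℕ}, (∀ j < e, ((p : ℤ) ^ j) • γ ≠ 0) →
      ∃ χ : G →+ UnitAddCircle, e ≠ 0 → χ (((p : ℤ) ^ (e - 1)) • γ) ≠ 0 := by
    intro γ e hmin
    by_cases he : e = 0
    · exact ⟨0, fun h ↦ (h he).elim⟩
    · obtain ⟨χ, hχ⟩ := exists_addMonoidHom_unitAddCircle_apply_ne_zero G
        (hmin (e - 1) (Nat.sub_one_lt he))
      exact ⟨χ, fun _ ↦ hχ⟩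
  obtain ⟨χ₁, hχ₁⟩ := hχ hmin₁
  obtain ⟨χ₂, hχ₂⟩ := hχ hmin₂
  -- one of `χ₁`, `χ₂`, `χ₁ + χ₂` works
  by_cases h12 : e₂ ≠ 0 → χ₁ (((p : ℤ) ^ (e₂ - 1)) • γ₂) ≠ 0
  · exact ⟨χ₁, apply_pow_smul_eq_zero_iff_of_apply_ne_zero χ₁ he₁ hχ₁,
      apply_pow_smul_eq_zero_iff_of_apply_ne_zero χ₁ he₂ h12⟩
  by_cases h21 : e₁ ≠ 0 → χ₂ (((p : ℤ) ^ (e₁ - 1)) • γ₁) ≠ 0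
  · exact ⟨χ₂, apply_pow_smul_eq_zero_iff_of_apply_ne_zero χ₂ he₁ h21,
      apply_pow_smul_eq_zero_iff_of_apply_ne_zero χ₂ he₂ hχ₂⟩
  -- `χ₁(b₂) = 0` and `χ₂(b₁) = 0`
  push Not at h12 h21
  obtain ⟨he₂0, h12⟩ := h12
  obtain ⟨he₁0, h21⟩ := h21
  refine ⟨χ₁ + χ₂, apply_pow_smul_eq_zero_iff_of_apply_ne_zero _ he₁ fun _ ↦ ?_,
    apply_pow_smul_eq_zero_iff_of_apply_ne_zero _ he₂ fun _ ↦ ?_⟩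
  · rw [AddMonoidHom.add_apply, h21, add_zero]
    exact hχ₁ he₁0
  · rw [AddMonoidHom.add_apply, h12, zero_add]
    exact hχ₂ he₂0

/-- **A character with prescribed kernel on two rays** (the input of Kolyvagin's order bound at
`p = 2`): `G` finite abelian killed by `p^M`, `K ≤ G`, `g₁, g₂ ∈ G`. There is `χ : G →+ ℝ/ℤ`
vanishing on `K` with **`χ(p^j g_k) = 0 ⟺ p^j g_k ∈ K`** for `k = 1, 2` and every `j` — McCallum's
`φ ∈ Hom(C, E_{p^M})` with kernel `⟨T⟩` read on the two rays `ℤ c(n_k)`, `ℤ s_{k+1}` his induction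
uses, for a ONE-line target. [cite: McCallumLMS1991, Prop. 3.1 and §5 (21)–(23)]
[cite: Serre1973, Chap. VI §1.1 Props. 1, 3] -/
theorem exists_addMonoidHom_unitAddCircle_two_rays [Finite G] {p M : ℕ}
    (hG : ∀ g : G, ((p : ℤ) ^ M) • g = 0) (K : AddSubgroup G) (g₁ g₂ : G) :
    ∃ χ : G →+ UnitAddCircle, (∀ k ∈ K, χ k = 0) ∧
      (∀ j : ℕ, χ (((p : ℤ) ^ j) • g₁) = 0 ↔ ((p : ℤ) ^ j) • g₁ ∈ K) ∧
      (∀ j : ℕ, χ (((p : ℤ) ^ j) • g₂) = 0 ↔ ((p : ℤ) ^ j) • g₂ ∈ K) := by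
  have hD : ∀ d : G ⧸ K, ((p : ℤ) ^ M) • d = 0 := by
    intro d
    induction d using QuotientAddGroup.induction_on with
    | H g => rw [← QuotientAddGroup.mk_zsmul, hG, QuotientAddGroup.mk_zero]
  obtain ⟨χ, h₁, h₂⟩ := exists_addMonoidHom_unitAddCircle_two_rays_of_torsion hD
    (QuotientAddGroup.mk g₁ : G ⧸ K) (QuotientAddGroup.mk g₂)
  refine ⟨χ.comp (QuotientAddGroup.mk' K), fun k hk ↦ ?_, fun j ↦ ?_, fun j ↦ ?_⟩
  · rw [AddMonoidHom.comp_apply, QuotientAddGroup.mk'_apply,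
      (QuotientAddGroup.eq_zero_iff k).mpr hk, map_zero]
  · rw [AddMonoidHom.comp_apply, QuotientAddGroup.mk'_apply, QuotientAddGroup.mk_zsmul, h₁,
      ← QuotientAddGroup.mk_zsmul, QuotientAddGroup.eq_zero_iff]
  · rw [AddMonoidHom.comp_apply, QuotientAddGroup.mk'_apply, QuotientAddGroup.mk_zsmul, h₂,
      ← QuotientAddGroup.mk_zsmul, QuotientAddGroup.eq_zero_iff]

end Literature.GroupTheory.FiniteAbelian
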